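import Mathlib
import Literature.AlgebraicGeometry.Resolution.PlaneGermBlowup
import Literature.AlgebraicGeometry.Resolution.CobordantChartPlaneSlice
import Literature.AlgebraicGeometry.Resolution.FormalCoordinateChange

/-!
# `WeightedInvariant.LocalWeightedDrop`, line `hasse-ridge-face-selection`: rescalings of plane germs

Crux item stmt-ResolutionOfSingularities-8899 (route `ResolutionOfSingularities/WeightedInvariant`),
skeleton v12 of the line `hasse-ridge-face-selection`, stub `stub_blowupScaling`, PROVED here
(statement verbatim from the ledger registration).  For the rescalings
`g ↦ μ · g(αx, βy) = C μ * subst (diagScale α β) g` of `k[[x, y]]` (`k` a field): (1)–(3) scalings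
compose, the trivial one is the identity, they commute with constants; (4) EQUIVARIANCE: a
first-neighbourhood transform germ of `μ g(αx, βy)` at the point of slope `t` (resp. the vertical
point) is a rescaling of the one of `g` at slope `βt/α` (resp. the vertical point); (5) normal
crossings and vanishing are invariant (`μ, α, β ≠ 0`); (6) the LITERAL chart of the game (the
weight-`(1,1)` chart `CobordantChart.chart 1 c`, then the slice at a slot `i` with `cᵢ ≠ 0`) applied
to `b ≠ 0` is a rescaling of `x ·` (strict transform of `b` in the normalised chart
`dirChart (c₁/c₀)` if `c₀ ≠ 0`, `vertChart` if `c₀ = 0`).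

**Proof.**  `subst (diagScale α β) = MvPowerSeries.rescale ![α, β]` (`rescale_eq_subst`), whence
the coefficient formula `coeff e (μ g(αx, βy)) = μ α^{e₀} β^{e₁} coeff e g`, (1)–(3), and the
invariance of the order and of vanishing.  (4): the chart families agree —
`dirChart t ∘ (μ · diagScale α β) = μ · diagScale α (β/α) ∘ dirChart (βt/α)` and
`vertChart ∘ (μ · diagScale α β) = μ · diagScale β (α/β) ∘ vertChart` (`subst_comp_subst_apply`) —
and `x^{ord}` cancels in the domain `k[[x, y]]`.  (5): conjugate the normal-crossing coordinates
`Φ` by the scaling (rows of the linear part get multiplied by `α⁻¹, β⁻¹`).  (6): `a = ord b`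
(`CobordantChart.eq_weightedOrder_of_factor`), the slice fixes `x`, and slice ∘ chart is
`(c₀x, x(c₁ + y)) = diagScale c₀ c₀⁻¹ ∘ dirChart (c₁/c₀)`, resp. `(xy, c₁x) = diagScale c₁ c₁⁻¹ ∘
vertChart`; unscaling by `diagScale γ⁻¹ γ` gives the transform germ `D = x · γ^{-a} G|ᵢ(γ⁻¹x, γy)`
with `x · G|ᵢ = (γ^a γ⁻¹) · D(γx, γ⁻¹y)`.
-/

set_option linter.dupNamespace false -- mandated namespace of this single-conjunct summit

namespace Summit.ResolutionOfSingularities.ResolutionOfSingularities.Theorems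

open Literature.AlgebraicGeometry.Resolution

namespace BlowupScaling

open MvPowerSeries

variable {k : Type} [Field k]

/-! ### Scalings are `MvPowerSeries.rescale` -/

/-- `g(αx, βy) = rescale ![α, β] g`. -/
theorem subst_diagScale (α β : k) (g : MvPowerSeries (Fin 2) k) :
    subst (PlaneGerm.diagScale α β) g = rescale ![α, β] g := by
  rw [rescale_eq_subst, show PlaneGerm.diagScale α β = (![α, β] • X : Fin 2 → MvPowerSeries (Fin 2) k)
    from funext fun i => by fin_cases i <;> simp [smul_eq_C_mul]]

/-- COEFFICIENT FORMULA: `coeff e (μ · g(αx, βy)) = μ α ^ e₀ β ^ e₁ coeff e g`. -/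
theorem coeff_scale (μ α β : k) (g : MvPowerSeries (Fin 2) k) (e : Fin 2 →₀ ℕ) :
    coeff e (C μ * subst (PlaneGerm.diagScale α β) g) = μ * α ^ (e 0) * β ^ (e 1) * coeff e g := by
  rw [coeff_C_mul, subst_diagScale, coeff_rescale, Finsupp.prod_fintype _ _ (fun i => by simp)]
  simp [Fin.prod_univ_two, mul_assoc]

/-- Clause 1: scalings compose, `g(α'x, β'y)(αx, βy) = g(α'α x, β'β y)`. -/
theorem subst_diagScale_subst_diagScale (α β α' β' : k) (g : MvPowerSeries (Fin 2) k) :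
    subst (PlaneGerm.diagScale α β) (subst (PlaneGerm.diagScale α' β') g) =
      subst (PlaneGerm.diagScale (α' * α) (β' * β)) g := by
  rw [subst_diagScale, subst_diagScale, subst_diagScale, rescale_rescale,
    show (![α', β'] * ![α, β] : Fin 2 → k) = ![α' * α, β' * β] from
      funext fun i => by fin_cases i <;> simp]

/-- Clause 2: the trivial scaling is the identity. -/
theorem subst_diagScale_one (g : MvPowerSeries (Fin 2) k) :
    subst (PlaneGerm.diagScale (1 : k) 1) g = g := by
  rw [subst_diagScale, show (![(1 : k), 1] : Fin 2 → k) = 1 from funext fun i => by fin_cases i <;> rfl,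
    rescale_one, RingHom.id_apply]

/-- Clause 3: scalings commute with constant factors. -/
theorem subst_diagScale_C_mul (α β μ : k) (g : MvPowerSeries (Fin 2) k) :
    subst (PlaneGerm.diagScale α β) (C μ * g) = C μ * subst (PlaneGerm.diagScale α β) g := by
  rw [subst_mul (PlaneGerm.hasSubst_diagScale α β), subst_C]

/-- Rescalings by non-zero scalars preserve the order (the support is unchanged). -/
theorem order_scale {μ α β : k} (hμ : μ ≠ 0) (hα : α ≠ 0) (hβ : β ≠ 0) (g : MvPowerSeries (Fin 2) k) :
    (C μ * subst (PlaneGerm.diagScale α β) g).order = g.order := by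
  have h : ∀ e, coeff e (C μ * subst (PlaneGerm.diagScale α β) g) = 0 ↔ coeff e g = 0 := fun e => by
    rw [coeff_scale]
    simp [hμ, hα, hβ]
  exact le_antisymm (le_order fun d hd => (h d).mp (coeff_of_lt_order hd))
    (le_order fun d hd => (h d).mpr (coeff_of_lt_order hd))

/-- Clause 5b: rescalings by non-zero scalars preserve vanishing. -/
theorem scale_eq_zero_iff {μ α β : k} (hμ : μ ≠ 0) (hα : α ≠ 0) (hβ : β ≠ 0)
    (g : MvPowerSeries (Fin 2) k) : C μ * subst (PlaneGerm.diagScale α β) g = 0 ↔ g = 0 := by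
  rw [← order_eq_top_iff, order_scale hμ hα hβ, order_eq_top_iff]

/-- Unscaling: `g = μ⁻¹ · g̃(α⁻¹ x, β⁻¹ y)` for `g̃ = μ · g(αx, βy)`. -/
theorem unscale {μ α β : k} (hμ : μ ≠ 0) (hα : α ≠ 0) (hβ : β ≠ 0) (g : MvPowerSeries (Fin 2) k) :
    C μ⁻¹ * subst (PlaneGerm.diagScale α⁻¹ β⁻¹) (C μ * subst (PlaneGerm.diagScale α β) g) = g := by
  rw [subst_diagScale_C_mul, subst_diagScale_subst_diagScale, mul_inv_cancel₀ hα, mul_inv_cancel₀ hβ,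
    subst_diagScale_one, ← mul_assoc, ← map_mul, inv_mul_cancel₀ hμ, map_one, one_mul]

/-- `C γ · C γ⁻¹ = 1` for `γ ≠ 0`. -/
theorem C_mul_C_inv {γ : k} (hγ : γ ≠ 0) : (C γ * C γ⁻¹ : MvPowerSeries (Fin 2) k) = 1 := by
  rw [← map_mul, mul_inv_cancel₀ hγ, map_one]

/-! ### Equivariance of the first-neighbourhood transforms -/

/-- Slope case: the families agree, `μ g(αx, βx(t + y)) = μ · [g(X, X(βt/α + Y))](αx, (β/α) y)`. -/
theorem subst_dirChart_scale {α : k} (hα : α ≠ 0) (μ β t : k) (g : MvPowerSeries (Fin 2) k) :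
    subst (PlaneGerm.dirChart t) (C μ * subst (PlaneGerm.diagScale α β) g) =
      C μ * subst (PlaneGerm.diagScale α (β / α)) (subst (PlaneGerm.dirChart (β * t / α)) g) := by
  have h1 := PlaneGerm.hasSubst_dirChart t
  have h2 := PlaneGerm.hasSubst_diagScale α (β / α)
  rw [subst_mul h1, subst_C, subst_comp_subst_apply (PlaneGerm.hasSubst_diagScale α β) h1,
    subst_comp_subst_apply (PlaneGerm.hasSubst_dirChart (β * t / α)) h2]
  congr 2
  funext s
  fin_cases s
  · simp [subst_mul h1, subst_X h1, subst_X h2]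
  · simp only [Fin.mk_one, PlaneGerm.diagScale_one, PlaneGerm.dirChart_one, subst_mul h1, subst_C,
      subst_X h1, subst_mul h2, subst_add h2, subst_X h2, PlaneGerm.diagScale_zero]
    rw [div_eq_mul_inv, div_eq_mul_inv]
    simp only [map_mul]
    linear_combination (-(C β * X (0 : Fin 2) * (C t + X 1))) * C_mul_C_inv hα

/-- Vertical case: the chart families agree, `μ g(αxy, βx) = μ · [g(XY, X)](βx, (α/β) y)`. -/
theorem subst_vertChart_scale {β : k} (hβ : β ≠ 0) (μ α : k) (g : MvPowerSeries (Fin 2) k) :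
    subst (PlaneGerm.vertChart k) (C μ * subst (PlaneGerm.diagScale α β) g) =
      C μ * subst (PlaneGerm.diagScale β (α / β)) (subst (PlaneGerm.vertChart k) g) := by
  have h1 := PlaneGerm.hasSubst_vertChart (k := k)
  have h2 := PlaneGerm.hasSubst_diagScale β (α / β)
  rw [subst_mul h1, subst_C, subst_comp_subst_apply (PlaneGerm.hasSubst_diagScale α β) h1,
    subst_comp_subst_apply h1 h2]
  congr 2
  funext s
  fin_cases s
  · simp only [Fin.mk_zero, PlaneGerm.diagScale_zero, PlaneGerm.vertChart_zero, subst_mul h1, subst_C,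
      subst_X h1, subst_mul h2, subst_X h2, PlaneGerm.diagScale_one]
    rw [div_eq_mul_inv, map_mul]
    linear_combination (-(C α * X (0 : Fin 2) * X 1)) * C_mul_C_inv hβ
  · simp [subst_mul h1, subst_X h1, subst_X h2]

/-- CANCELLATION.  If `b∘Ψ = μ · (b'∘Ψ')(γx, δy)` with `μ, γ, δ ≠ 0` and `ord b = ord b'`, then the
transform germ of `b` in `Ψ` is the rescaling `(μ γ^{m-1}) · D'(γx, δy)` of that of `b'` in `Ψ'`. -/
theorem transform_scale {Ψ Ψ' : Fin 2 → MvPowerSeries (Fin 2) k} {b b' D D' : MvPowerSeries (Fin 2) k}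
    {μ γ δ : k} (hμ : μ ≠ 0) (hγ : γ ≠ 0) (hδ : δ ≠ 0) (hord : b.order = b'.order)
    (hrel : subst Ψ b = C μ * subst (PlaneGerm.diagScale γ δ) (subst Ψ' b'))
    (hD : PlaneGerm.IsTransform Ψ b D) (hD' : PlaneGerm.IsTransform Ψ' b' D') :
    ∃ (μ' α' β' : k), μ' ≠ 0 ∧ α' ≠ 0 ∧ β' ≠ 0 ∧
      D = C μ' * subst (PlaneGerm.diagScale α' β') D' := by
  obtain ⟨m, st, hm, hst, rfl⟩ := hD
  obtain ⟨m', st', hm', hst', rfl⟩ := hD'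
  obtain rfl : m = m' := by
    rw [hord, hm'] at hm
    exact_mod_cast hm.symm
  have hd := PlaneGerm.hasSubst_diagScale γ δ
  rw [hst, hst', subst_mul hd, subst_pow hd, subst_X hd, PlaneGerm.diagScale_zero] at hrel
  -- cancel `x^m`: `st = μ γ^m · st'(γx, δy)`
  have key : st = C (μ * γ ^ m) * subst (PlaneGerm.diagScale γ δ) st' := by
    apply mul_left_cancel₀ (pow_ne_zero m (FormalCoordChange.X_ne_zero' (0 : Fin 2)))
    rw [hrel, map_mul, map_pow, mul_pow]
    ring
  refine ⟨μ * γ ^ m * γ⁻¹, γ, δ, mul_ne_zero (mul_ne_zero hμ (pow_ne_zero m hγ)) (inv_ne_zero hγ),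
    hγ, hδ, ?_⟩
  rw [key, subst_mul hd, subst_X hd, PlaneGerm.diagScale_zero]
  simp only [map_mul, map_pow]
  linear_combination (-(X (0 : Fin 2) * C μ * C γ ^ m * subst (PlaneGerm.diagScale γ δ) st')) *
    C_mul_C_inv hγ

/-! ### Normal crossings are invariant under rescalings -/

/-- If the support of `g` is a normal crossing then so is the support of `μ · g(αx, βy)`
(`μ, α, β ≠ 0`): conjugate the coordinates `Φ` by the scaling, `Φ' = (α⁻¹ Φ₀, β⁻¹ Φ₁)`. -/
theorem isNC_scale {μ α β : k} (hμ : μ ≠ 0) (hα : α ≠ 0) (hβ : β ≠ 0) {g : MvPowerSeries (Fin 2) k}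
    (h : PlaneGerm.IsNC g) : PlaneGerm.IsNC (C μ * subst (PlaneGerm.diagScale α β) g) := by
  obtain ⟨Φ, u, a, c, hΦ0, hdet, hu, hsub⟩ := h
  have hΦ'0 : ∀ i, constantCoeff
      ((![C α⁻¹ * Φ 0, C β⁻¹ * Φ 1] : Fin 2 → MvPowerSeries (Fin 2) k) i) = 0 := fun i => by
    fin_cases i <;> simp [hΦ0]
  have hΦ' := hasSubst_of_constantCoeff_zero hΦ'0
  refine ⟨![C α⁻¹ * Φ 0, C β⁻¹ * Φ 1], C μ * u, a, c, hΦ'0, ?_, ?_, ?_⟩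
  · -- the linear part: rows scaled by `α⁻¹`, `β⁻¹`
    rw [Matrix.det_fin_two, isUnit_iff_ne_zero] at hdet ⊢
    simp only [Matrix.of_apply, Matrix.cons_val_zero, Matrix.cons_val_one, coeff_C_mul] at hdet ⊢
    convert mul_ne_zero (mul_ne_zero (inv_ne_zero hα) (inv_ne_zero hβ)) hdet using 1
    ring
  · rw [map_mul, constantCoeff_C]
    exact mul_ne_zero hμ hu
  · rw [subst_mul hΦ', subst_C, subst_comp_subst_apply (PlaneGerm.hasSubst_diagScale α β) hΦ']
    have hfam : (fun s => subst (![C α⁻¹ * Φ 0, C β⁻¹ * Φ 1] : Fin 2 → MvPowerSeries (Fin 2) k)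
        (PlaneGerm.diagScale α β s)) = Φ := by
      funext s
      fin_cases s
      · simp only [Fin.mk_zero, PlaneGerm.diagScale_zero, subst_mul hΦ', subst_C, subst_X hΦ',
          Matrix.cons_val_zero]
        rw [← mul_assoc, ← map_mul, mul_inv_cancel₀ hα, map_one, one_mul]
      · simp only [Fin.mk_one, PlaneGerm.diagScale_one, subst_mul hΦ', subst_C, subst_X hΦ',
          Matrix.cons_val_one, Matrix.cons_val_zero]
        rw [← mul_assoc, ← map_mul, mul_inv_cancel₀ hβ, map_one, one_mul]
    rw [hfam, hsub]
    ring

/-- Clause 5a: the normal-crossing property of the support is invariant under rescalings. -/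
theorem isNC_scale_iff {μ α β : k} (hμ : μ ≠ 0) (hα : α ≠ 0) (hβ : β ≠ 0)
    (g : MvPowerSeries (Fin 2) k) :
    PlaneGerm.IsNC (C μ * subst (PlaneGerm.diagScale α β) g) ↔ PlaneGerm.IsNC g := by
  refine ⟨fun h => ?_, isNC_scale hμ hα hβ⟩
  have h' := isNC_scale (inv_ne_zero hμ) (inv_ne_zero hα) (inv_ne_zero hβ) h
  rwa [unscale hμ hα hβ] at h'

/-! ### The literal chart of the game is a rescaled normalised chart -/

/-- The plane slice `i = 0` (`y₀ ↦ 0`, `y₁ ↦ y`) is the family `(x, 0, y)`. -/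
theorem slice_zero_eq : (fun j : Fin 3 => if j = (0 : Fin 2).succ then (0 : MvPowerSeries (Fin 2) k)
    else X (Fin.predAbove 0 j)) = ![X 0, 0, X 1] := by
  funext j
  fin_cases j <;> rfl

/-- The plane slice `i = 1` (`y₀ ↦ y`, `y₁ ↦ 0`) is the family `(x, y, 0)`. -/
theorem slice_one_eq : (fun j : Fin 3 => if j = (1 : Fin 2).succ then (0 : MvPowerSeries (Fin 2) k)
    else X (Fin.predAbove 1 j)) = ![X 0, X 1, 0] := by
  funext j
  fin_cases j <;> rfl

/-- The weight-`(1,1)` chart satisfies the convention `wᵢ = 0 → cᵢ = 0` vacuously. -/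
theorem chart_convention (c : Fin 2 → k) : ∀ i, (fun _ : Fin 2 => 1) i = 0 → c i = 0 :=
  fun _ hi => absurd hi one_ne_zero

/-- The slice `i = 0` after the weight-`(1,1)` chart `c` is `(c₀ x, x (c₁ + y))`, i.e. for `c₀ ≠ 0`
the rescaling `(c₀ x, c₀⁻¹ y)` after the chart of slope `c₁ / c₀`. -/
theorem slice_zero_chart {c : Fin 2 → k} (h0 : c 0 ≠ 0) (b : MvPowerSeries (Fin 2) k) :
    subst (fun j : Fin 3 => if j = (0 : Fin 2).succ then (0 : MvPowerSeries (Fin 2) k)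
        else X (Fin.predAbove 0 j)) (subst (CobordantChart.chart (fun _ : Fin 2 => 1) c) b) =
      subst (PlaneGerm.diagScale (c 0) (c 0)⁻¹) (subst (PlaneGerm.dirChart (c 1 / c 0)) b) := by
  have hS : HasSubst (![X 0, 0, X 1] : Fin 3 → MvPowerSeries (Fin 2) k) :=
    hasSubst_of_constantCoeff_zero fun j => by fin_cases j <;> simp [constantCoeff_X]
  have hD := PlaneGerm.hasSubst_diagScale (c 0) (c 0)⁻¹
  rw [slice_zero_eq, subst_comp_subst_apply (CobordantChart.hasSubst_chart _ c (chart_convention c)) hS,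
    subst_comp_subst_apply (PlaneGerm.hasSubst_dirChart (c 1 / c 0)) hD]
  congr 2
  funext s
  simp only [CobordantChart.chart_apply, pow_one, subst_mul hS, subst_add hS, subst_C, subst_X hS]
  fin_cases s
  · simp [subst_X hD]
    ring
  · simp only [Fin.mk_one, Fin.succ_one_eq_two, Matrix.cons_val_zero, Matrix.cons_val_two,
      Matrix.tail_cons, Matrix.head_cons, PlaneGerm.dirChart_one, subst_mul hD, subst_add hD, subst_C,
      subst_X hD, PlaneGerm.diagScale_zero, PlaneGerm.diagScale_one, div_eq_mul_inv, map_mul]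
    linear_combination (-(X (0 : Fin 2) * (C (c 1) + X 1))) * C_mul_C_inv h0

/-- The slice `i = 1` after the weight-`(1,1)` chart `c` with `c₀ = 0` is `(x y, c₁ x)`, i.e. for
`c₁ ≠ 0` the rescaling `(c₁ x, c₁⁻¹ y)` after the vertical chart. -/
theorem slice_one_chart {c : Fin 2 → k} (h0 : c 0 = 0) (h1 : c 1 ≠ 0) (b : MvPowerSeries (Fin 2) k) :
    subst (fun j : Fin 3 => if j = (1 : Fin 2).succ then (0 : MvPowerSeries (Fin 2) k)
        else X (Fin.predAbove 1 j)) (subst (CobordantChart.chart (fun _ : Fin 2 => 1) c) b) =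
      subst (PlaneGerm.diagScale (c 1) (c 1)⁻¹) (subst (PlaneGerm.vertChart k) b) := by
  have hS : HasSubst (![X 0, X 1, 0] : Fin 3 → MvPowerSeries (Fin 2) k) :=
    hasSubst_of_constantCoeff_zero fun j => by fin_cases j <;> simp [constantCoeff_X]
  have hD := PlaneGerm.hasSubst_diagScale (c 1) (c 1)⁻¹
  rw [slice_one_eq, subst_comp_subst_apply (CobordantChart.hasSubst_chart _ c (chart_convention c)) hS,
    subst_comp_subst_apply PlaneGerm.hasSubst_vertChart hD]
  congr 2
  funext s
  simp only [CobordantChart.chart_apply, pow_one, subst_mul hS, subst_add hS, subst_C, subst_X hS]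
  fin_cases s
  · simp only [Fin.mk_zero, Fin.succ_zero_eq_one, Matrix.cons_val_zero, Matrix.cons_val_one,
      PlaneGerm.vertChart_zero, subst_mul hD, subst_X hD, PlaneGerm.diagScale_zero,
      PlaneGerm.diagScale_one, h0, map_zero, zero_add]
    linear_combination (-(X (0 : Fin 2) * X 1)) * C_mul_C_inv h1
  · simp [subst_X hD]
    ring

/-- UNSCALING.  From `x^a · S = (b∘Ψ)(γx, γ⁻¹y)` with `ord b = a` and `γ ≠ 0`:
`D := x · γ^{-a} S(γ⁻¹x, γy)` is a transform germ of `b` in the chart `Ψ`, and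
`x · S = (γ^a γ⁻¹) · D(γx, γ⁻¹y)`. -/
theorem literal_of_normalised {Ψ : Fin 2 → MvPowerSeries (Fin 2) k} {b S : MvPowerSeries (Fin 2) k}
    {γ : k} {a : ℕ} (hγ : γ ≠ 0) (hord : b.order = a)
    (hrel : X 0 ^ a * S = subst (PlaneGerm.diagScale γ γ⁻¹) (subst Ψ b)) :
    ∃ (D : MvPowerSeries (Fin 2) k) (μ α β : k), μ ≠ 0 ∧ α ≠ 0 ∧ β ≠ 0 ∧
      PlaneGerm.IsTransform Ψ b D ∧ X 0 * S = C μ * subst (PlaneGerm.diagScale α β) D := by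
  have hd := PlaneGerm.hasSubst_diagScale (k := k) γ γ⁻¹
  have hd' := PlaneGerm.hasSubst_diagScale (k := k) γ⁻¹ γ
  -- unscale: `b∘Ψ = x^a · st` with `st := γ^{-a} · S(γ⁻¹ x, γ y)`
  have hΨ : subst Ψ b = X 0 ^ a * (C (γ⁻¹ ^ a) * subst (PlaneGerm.diagScale γ⁻¹ γ) S) := by
    have h := congrArg (subst (PlaneGerm.diagScale γ⁻¹ γ)) hrel
    rw [subst_diagScale_subst_diagScale, mul_inv_cancel₀ hγ, inv_mul_cancel₀ hγ,
      subst_diagScale_one] at h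
    rw [← h, subst_mul hd', subst_pow hd', subst_X hd', PlaneGerm.diagScale_zero, mul_pow, ← map_pow]
    ring
  refine ⟨X 0 * (C (γ⁻¹ ^ a) * subst (PlaneGerm.diagScale γ⁻¹ γ) S), γ ^ a * γ⁻¹, γ, γ⁻¹,
    mul_ne_zero (pow_ne_zero a hγ) (inv_ne_zero hγ), hγ, inv_ne_zero hγ, ⟨a, _, hord, hΨ, rfl⟩, ?_⟩
  rw [subst_mul hd, subst_X hd, PlaneGerm.diagScale_zero, subst_diagScale_C_mul,
    subst_diagScale_subst_diagScale, inv_mul_cancel₀ hγ, mul_inv_cancel₀ hγ, subst_diagScale_one]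
  have hs : γ ^ a * γ⁻¹ * γ * γ⁻¹ ^ a = 1 := by
    rw [inv_pow, mul_assoc (γ ^ a), inv_mul_cancel₀ hγ, mul_one, mul_inv_cancel₀ (pow_ne_zero a hγ)]
  rw [show C (γ ^ a * γ⁻¹) * (C γ * X (0 : Fin 2) * (C (γ⁻¹ ^ a) * S)) =
      C (γ ^ a * γ⁻¹ * γ * γ⁻¹ ^ a) * (X (0 : Fin 2) * S) from by simp only [map_mul, map_pow]; ring,
    hs, map_one, one_mul]

/-- Clause 6: at every exceptional point `c ≠ 0` of the weight-`(1,1)` chart, a slot `i` with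
`cᵢ ≠ 0` slices the `s`-saturated transform `G` of `b ≠ 0` to a rescaled first-neighbourhood germ
of `b` divided by `x`. -/
theorem literal_chart (b : MvPowerSeries (Fin 2) k) (hb : b ≠ 0) (c : Fin 2 → k) (hc : c ≠ 0)
    (a : ℕ) (G : MvPowerSeries (Fin 3) k)
    (hfac : subst (CobordantChart.chart (fun _ : Fin 2 => 1) c) b = X 0 ^ a * G)
    (hG : ¬ (X (0 : Fin 3) ∣ G)) :
    ∃ i : Fin 2, c i ≠ 0 ∧ ∃ (D : MvPowerSeries (Fin 2) k) (μ α β : k), μ ≠ 0 ∧ α ≠ 0 ∧ β ≠ 0 ∧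
      PlaneGerm.IsSuccessor b D ∧
      X 0 * subst (fun j : Fin 3 => if j = i.succ then (0 : MvPowerSeries (Fin 2) k)
        else X (Fin.predAbove i j)) G = C μ * subst (PlaneGerm.diagScale α β) D := by
  -- `a = ord b`
  have hord : b.order = a := by
    have h := CobordantChart.eq_weightedOrder_of_factor _ c (chart_convention c) hb hfac hG
    change (a : ℕ∞) = b.order at h
    exact h.symm
  -- the slice fixes `x = X 0`: `(b∘chart)|ᵢ = x^a · G|ᵢ`
  have hslice : ∀ i : Fin 2,
      subst (fun j : Fin 3 => if j = i.succ then (0 : MvPowerSeries (Fin 2) k)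
          else X (Fin.predAbove i j)) (subst (CobordantChart.chart (fun _ : Fin 2 => 1) c) b) =
        X 0 ^ a * subst (fun j : Fin 3 => if j = i.succ then (0 : MvPowerSeries (Fin 2) k)
          else X (Fin.predAbove i j)) G := by
    intro i
    have hS := CobordantChartPlaneSlice.hasSubst_slice (R := k) i
    rw [hfac, subst_mul hS, subst_pow hS, subst_X hS]
    simp [(Fin.succ_ne_zero i).symm]
  by_cases h0 : c 0 = 0
  · -- the vertical point: `c₁ ≠ 0`, slot `i = 1`
    have h1 : c 1 ≠ 0 := by
      intro h1
      apply hc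
      funext i
      fin_cases i
      · exact h0
      · exact h1
    have hrel : X 0 ^ a * subst (fun j : Fin 3 => if j = (1 : Fin 2).succ then
        (0 : MvPowerSeries (Fin 2) k) else X (Fin.predAbove 1 j)) G =
          subst (PlaneGerm.diagScale (c 1) (c 1)⁻¹) (subst (PlaneGerm.vertChart k) b) := by
      rw [← hslice 1, slice_one_chart h0 h1]
    obtain ⟨D, μ, α, β, hμ, hα, hβ, hT, hEq⟩ := literal_of_normalised h1 hord hrel
    exact ⟨1, h1, D, μ, α, β, hμ, hα, hβ, Or.inr hT, hEq⟩
  · -- a point of finite slope `c₁ / c₀`, slot `i = 0`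
    have hrel : X 0 ^ a * subst (fun j : Fin 3 => if j = (0 : Fin 2).succ then
        (0 : MvPowerSeries (Fin 2) k) else X (Fin.predAbove 0 j)) G =
          subst (PlaneGerm.diagScale (c 0) (c 0)⁻¹) (subst (PlaneGerm.dirChart (c 1 / c 0)) b) := by
      rw [← hslice 0, slice_zero_chart h0]
    obtain ⟨D, μ, α, β, hμ, hα, hβ, hT, hEq⟩ := literal_of_normalised h0 hord hrel
    exact ⟨0, h0, D, μ, α, β, hμ, hα, hβ, Or.inl ⟨_, hT⟩, hEq⟩

end BlowupScaling

open BlowupScaling in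
/-- RESCALINGS OF PLANE GERMS, stub `stub_blowupScaling` of the line `hasse-ridge-face-selection` of
crux `LocalWeightedDrop` (stmt-ResolutionOfSingularities-8899): for `g ↦ μ · g(αx, βy)` on `k[[x, y]]`,
(1)–(3) the action, (4) equivariance of the first-neighbourhood transform germs, (5) invariance of
normal crossings and vanishing, (6) the literal weight-`(1,1)` chart followed by a slice is a rescaled
normalised first-neighbourhood germ. -/
theorem stub_blowupScaling : ∀ (k : Type) [Field k],
    (∀ (α β α' β' : k) (g : MvPowerSeries (Fin 2) k),
      MvPowerSeries.subst (PlaneGerm.diagScale α β) (MvPowerSeries.subst (PlaneGerm.diagScale α' β') g) =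
        MvPowerSeries.subst (PlaneGerm.diagScale (α' * α) (β' * β)) g) ∧
    (∀ g : MvPowerSeries (Fin 2) k, MvPowerSeries.subst (PlaneGerm.diagScale (1 : k) 1) g = g) ∧
    (∀ (α β μ : k) (g : MvPowerSeries (Fin 2) k),
      MvPowerSeries.subst (PlaneGerm.diagScale α β) (MvPowerSeries.C μ * g) =
        MvPowerSeries.C μ * MvPowerSeries.subst (PlaneGerm.diagScale α β) g) ∧
    (∀ (μ α β : k), μ ≠ 0 → α ≠ 0 → β ≠ 0 → ∀ g : MvPowerSeries (Fin 2) k,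
      (∀ t : k, ∃ t' : k, ∀ D D' : MvPowerSeries (Fin 2) k,
        PlaneGerm.IsTransform (PlaneGerm.dirChart t)
          (MvPowerSeries.C μ * MvPowerSeries.subst (PlaneGerm.diagScale α β) g) D →
        PlaneGerm.IsTransform (PlaneGerm.dirChart t') g D' →
        ∃ (μ' α' β' : k), μ' ≠ 0 ∧ α' ≠ 0 ∧ β' ≠ 0 ∧
          D = MvPowerSeries.C μ' * MvPowerSeries.subst (PlaneGerm.diagScale α' β') D') ∧
      (∀ D D' : MvPowerSeries (Fin 2) k,
        PlaneGerm.IsTransform (PlaneGerm.vertChart k)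
          (MvPowerSeries.C μ * MvPowerSeries.subst (PlaneGerm.diagScale α β) g) D →
        PlaneGerm.IsTransform (PlaneGerm.vertChart k) g D' →
        ∃ (μ' α' β' : k), μ' ≠ 0 ∧ α' ≠ 0 ∧ β' ≠ 0 ∧
          D = MvPowerSeries.C μ' * MvPowerSeries.subst (PlaneGerm.diagScale α' β') D')) ∧
    (∀ (μ α β : k), μ ≠ 0 → α ≠ 0 → β ≠ 0 → ∀ g : MvPowerSeries (Fin 2) k,
      (PlaneGerm.IsNC (MvPowerSeries.C μ * MvPowerSeries.subst (PlaneGerm.diagScale α β) g) ↔ PlaneGerm.IsNC g) ∧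
      (MvPowerSeries.C μ * MvPowerSeries.subst (PlaneGerm.diagScale α β) g = 0 ↔ g = 0)) ∧
    (∀ b : MvPowerSeries (Fin 2) k, b ≠ 0 → ∀ c : Fin 2 → k, c ≠ 0 →
      ∀ (a : ℕ) (G : MvPowerSeries (Fin 3) k),
        MvPowerSeries.subst (CobordantChart.chart (fun _ : Fin 2 => 1) c) b = MvPowerSeries.X 0 ^ a * G →
        ¬ (MvPowerSeries.X (0 : Fin 3) ∣ G) →
        ∃ i : Fin 2, c i ≠ 0 ∧ ∃ (D : MvPowerSeries (Fin 2) k) (μ α β : k), μ ≠ 0 ∧ α ≠ 0 ∧ β ≠ 0 ∧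
          PlaneGerm.IsSuccessor b D ∧
          MvPowerSeries.X 0 * MvPowerSeries.subst (fun j : Fin 3 => if j = i.succ then (0 : MvPowerSeries (Fin 2) k)
              else MvPowerSeries.X (Fin.predAbove i j)) G =
            MvPowerSeries.C μ * MvPowerSeries.subst (PlaneGerm.diagScale α β) D) := by
  intro k _
  exact ⟨fun α β α' β' g => subst_diagScale_subst_diagScale α β α' β' g, subst_diagScale_one,
    fun α β μ g => subst_diagScale_C_mul α β μ g,
    fun μ α β hμ hα hβ g => ⟨fun t => ⟨β * t / α, fun _ _ hD hD' => transform_scale hμ hα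
      (div_ne_zero hβ hα) (order_scale hμ hα hβ g) (subst_dirChart_scale hα μ β t g) hD hD'⟩,
      fun _ _ hD hD' => transform_scale hμ hβ (div_ne_zero hα hβ) (order_scale hμ hα hβ g)
        (subst_vertChart_scale hβ μ α g) hD hD'⟩,
    fun μ α β hμ hα hβ g => ⟨isNC_scale_iff hμ hα hβ g, scale_eq_zero_iff hμ hα hβ g⟩,
    literal_chart⟩

end Summit.ResolutionOfSingularities.ResolutionOfSingularities.Theorems
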